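import Summits.AtomisticToContinuum.Crystallization.Theses.PhononSlackCertificates
import Summits.AtomisticToContinuum.Crystallization.Theorems.ChargedEnergyGap.Negative.BlocksLocal
import Summits.AtomisticToContinuum.Crystallization.Theorems.ChargedEnergyGap.Negative.BlocksBound
import Summits.AtomisticToContinuum.Crystallization.Theorems.PhononSlackCertificatesCoerciveTwoShellGapSepReduction
import Summits.AtomisticToContinuum.Crystallization.Theorems.PhononSlackCertificatesCoerciveTwoShellGapPeriodisation

/-!
# Crux `CoerciveTwoShellGap` (stmt-AtomisticToContinuum-13956), line `Sketch`: the crux implies its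
# torus form (trial blocks), so the line's residual core is EQUIVALENT to the crux

With the landed stubs `stub_sepReduction` and `stub_periodisation` the crux follows from the
TWO-SHELL GAP ON THE TORUS

  `∃ g > 0, ∀ P : PeriodicConfiguration 3, P.points 1/3-separated →
      e* + g · #{y ∈ motif : ¬ IsTwoShellGoodSet (1/20) (47/50) 1 P.points y}/#motif ≤ e(P)`.

This file proves the CONVERSE `torusTwoShellGap_of_coerciveTwoShellGap` (same `g`, crux at
`δ = 1/3`), hence `coerciveTwoShellGap_iff_torusTwoShellGap`: crux and torus form are ONE statement
of the tree.  Trial-block argument of `ReggeStarCoercivityPeriodicStarCoercivityOfStarCoercivity`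
(one-shell predicate) re-run for the two-shell predicate on the landed block infrastructure
`ChargedEnergyGap.Negative.Blocks*`: block energy `E_LJ(x_K) ≤ N (e(P) + ε)` for `K ≥ K₀(ε)`
(`Blocks.exists_block_energy_le`); at `depth P 2`-deep block points the index is `1/20`-good in
`x_K` iff the point is `1/20`-good in `P.points` (`block_good_iff`, via
`Blocks.exists_eq_toP_of_dist_lt`; set goodness is lattice invariant, `isTwoShellGoodSet_add_iff`);
at most `6 d K²` coordinate triples are not deep, so `#bad(x_K) ≥ #bad motif · (K³ − 6 d K²)`;
feed `x_K` to the crux, divide by `#motif · K³`, let `K → ∞`, `ε → 0`.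
-/

noncomputable section

namespace Summit.AtomisticToContinuum.Crystallization.Theorems.CoerciveTwoShellGapBlocks

open scoped BigOperators Classical
open Literature.MathematicalPhysics.StatisticalMechanics Literature.Geometry.DiscreteGeometry
open Summit.AtomisticToContinuum.Crystallization.Theorems.ChargedEnergyGapNegative
open Summit.AtomisticToContinuum.Crystallization.Theorems.CoerciveTwoShellGapSepReduction
  (dist_lt_of_matched)
open Summit.AtomisticToContinuum.Crystallization.Theorems.CoerciveTwoShellGapPeriodisation
  (one_le_norm_of_mem_twoShellPattern)

variable (P : PeriodicConfiguration 3) (K : ℕ)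

/-! ## Set goodness is invariant under the lattice of periods -/

/-- Translating a set-goodness certificate by a period `g` of `P`. [folklore] -/
theorem isTwoShellGoodSet_add {ε lo hi : ℝ} {g : EuclideanSpace ℝ (Fin 3)} (hg : g ∈ P.lattice)
    {y : EuclideanSpace ℝ (Fin 3)} (h : IsTwoShellGoodSet ε lo hi P.points y) :
    IsTwoShellGoodSet ε lo hi P.points (y + g) := by
  obtain ⟨a, ha₁, ha₂, A, Pat, f, hPat, hf, hinj, hcov⟩ := h
  refine ⟨a, ha₁, ha₂, A, Pat, fun v => f v + g, hPat,
    fun v hv => ⟨P.add_mem_points (hf v hv).1 hg, ?_⟩, ?_, ?_⟩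
  · have : y + g + a • A v = (y + a • A v) + g := by abel
    rw [this, dist_add_right]
    exact (hf v hv).2
  · intro v hv w hw hvw
    exact hinj hv hw (add_right_cancel hvw)
  · intro z hz hzy hd
    have hz' : z - g ∈ P.points := by
      simpa [sub_eq_add_neg] using P.add_mem_points hz (P.lattice.neg_mem hg)
    have hne : z - g ≠ y := fun h => hzy (by rw [← h]; abel)
    have hd' : dist (z - g) y ≤ 3 / 2 * a := by
      have : dist (z - g) y = dist z (y + g) := by
        rw [dist_eq_norm, dist_eq_norm]
        congr 1
        abel
      rw [this]
      exact hd
    obtain ⟨v, hv, hfv⟩ := hcov (z - g) hz' hne hd'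
    exact ⟨v, hv, by simp only [hfv, sub_add_cancel]⟩

/-- **Set goodness is invariant under the periods of `P`.** [folklore] -/
theorem isTwoShellGoodSet_add_iff {ε lo hi : ℝ} {g : EuclideanSpace ℝ (Fin 3)} (hg : g ∈ P.lattice)
    (y : EuclideanSpace ℝ (Fin 3)) :
    IsTwoShellGoodSet ε lo hi P.points (y + g) ↔ IsTwoShellGoodSet ε lo hi P.points y := by
  refine ⟨fun h => ?_, isTwoShellGoodSet_add P hg⟩
  have := isTwoShellGoodSet_add P (P.lattice.neg_mem hg) h
  simpa using this

/-! ## Deep block points: goodness in the block is goodness in `P.points` -/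

/-- **Goodness transfer at deep block points.**  At a block point of `x_K = Blocks.blockConfig P K`
whose lattice coordinates are `depth P 2`-deep, the index is `1/20`-good in the finite block iff
the point is `1/20`-good in `P.points`: both certificates only involve points within
`(√2 + 1/20)·a < 3/2` resp. `3a/2 ≤ 3/2 < 2` of the centre, and every point of `P.points` within
distance `< 2` of a deep block point is a block point (`Blocks.exists_eq_toP_of_dist_lt`). [folklore] -/
theorem block_good_iff {a : Fin (Fintype.card (Blocks.BIdx P K))}
    (hdeep : Blocks.IsDeep K (Blocks.depth P 2) ((Fintype.equivFin (Blocks.BIdx P K)).symm a).2) :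
    IsTwoShellGood (1 / 20) (47 / 50) 1 (Blocks.blockConfig P K) a ↔
      IsTwoShellGoodSet (1 / 20) (47 / 50) 1 P.points (Blocks.blockConfig P K a) := by
  set x := Blocks.blockConfig P K with hxdef
  set e := Fintype.equivFin (Blocks.BIdx P K) with he
  have hxa : ∀ b, x b = Blocks.bpt P K (e.symm b) := fun b => rfl
  have hxinj : Function.Injective x := Blocks.blockConfig_injective P K
  -- points of `P` near `x a` are block points
  have hblock : ∀ z ∈ P.points, z ≠ x a → dist z (x a) < 2 → ∃ j, j ≠ a ∧ x j = z := by
    intro z hz hza hd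
    have hne : (⟨z, hz⟩ : P.points) ≠ Blocks.toP P K (e.symm a) := by
      intro h
      apply hza
      have := congrArg Subtype.val h
      simpa [hxa] using this
    have hlt : dist (Blocks.bpt P K (e.symm a)) z < 2 := by rw [← hxa, dist_comm]; exact hd
    obtain ⟨v, hv, hvq⟩ := Blocks.exists_eq_toP_of_dist_lt P K hdeep ⟨z, hz⟩ hne hlt
    refine ⟨e v, fun h => hv (by simpa using congrArg e.symm h), ?_⟩
    rw [hxa (e v)]
    simpa using congrArg Subtype.val hvq
  constructor
  · rintro ⟨r, hr₁, hr₂, A, Pat, f, hPat, hf, hinj, hcov⟩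
    refine ⟨r, hr₁, hr₂, A, Pat, fun v => x (f v), hPat, fun v hv => ⟨?_, (hf v hv).2⟩, ?_, ?_⟩
    · show x (f v) ∈ P.points
      rw [hxa]; exact Blocks.bpt_mem P K _
    · intro v hv w hw hvw
      exact hinj hv hw (hxinj hvw)
    · intro z hz hza hd
      have hr0 : 0 ≤ r := le_trans (by norm_num) hr₁
      have hd2 : dist z (x a) < 2 := lt_of_le_of_lt hd (by nlinarith)
      obtain ⟨j, hja, rfl⟩ := hblock z hz hza hd2
      obtain ⟨v, hv, hfv⟩ := hcov j hja hd
      exact ⟨v, hv, by show x (f v) = x j; rw [hfv]⟩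
  · rintro ⟨r, hr₁, hr₂, A, Pat, f, hPat, hf, hinj, hcov⟩
    have hr0 : 0 < r := lt_of_lt_of_le (by norm_num) hr₁
    -- matched points are block points other than `x a`
    have hne : ∀ v ∈ Pat, f v ≠ x a := by
      intro v hv hfv
      have hv1 := one_le_norm_of_mem_twoShellPattern hPat hv
      have hd := (hf v hv).2
      rw [hfv, dist_comm, dist_eq_norm, add_sub_cancel_left, norm_smul, Real.norm_of_nonneg hr0.le,
        A.norm_map] at hd
      have h1 : r * 1 ≤ r * ‖v‖ := mul_le_mul_of_nonneg_left hv1 hr0.le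
      linarith
    have hex : ∀ v ∈ Pat, ∃ j, x j = f v := by
      intro v hv
      have hd : dist (f v) (x a) < 2 :=
        (dist_lt_of_matched hr₁ hr₂ A hPat hv (hf v hv).2).trans (by norm_num)
      obtain ⟨j, -, hj⟩ := hblock (f v) (hf v hv).1 (hne v hv) hd
      exact ⟨j, hj⟩
    obtain ⟨f', hf'⟩ : ∃ f' : EuclideanSpace ℝ (Fin 3) → Fin (Fintype.card (Blocks.BIdx P K)),
        ∀ v ∈ Pat, x (f' v) = f v :=
      ⟨fun v => if h : ∃ j, x j = f v then h.choose else a, fun v hv => by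
        simp only [dif_pos (hex v hv)]
        exact (hex v hv).choose_spec⟩
    refine ⟨r, hr₁, hr₂, A, Pat, f', hPat, fun v hv => ⟨?_, ?_⟩, ?_, ?_⟩
    · intro hfa
      exact hne v hv (by rw [← hf' v hv, hfa])
    · rw [hf' v hv]
      exact (hf v hv).2
    · intro v hv w hw hvw
      exact hinj hv hw (by rw [← hf' v hv, ← hf' w hw, hvw])
    · intro j hja hd
      have hjP : x j ∈ P.points := by rw [hxa]; exact Blocks.bpt_mem P K _
      obtain ⟨v, hv, hfv⟩ := hcov (x j) hjP (hxinj.ne hja) hd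
      exact ⟨v, hv, hxinj (by rw [hf' v hv, hfv])⟩

/-- **Status transfer to the motif.**  A `depth P 2`-deep block point is `1/20`-bad in the finite
block iff its motif representative is `1/20`-bad in `P.points` (`block_good_iff` and lattice
invariance `isTwoShellGoodSet_add_iff`). [folklore] -/
theorem block_bad_iff {a : Fin (Fintype.card (Blocks.BIdx P K))}
    (hdeep : Blocks.IsDeep K (Blocks.depth P 2) ((Fintype.equivFin (Blocks.BIdx P K)).symm a).2) :
    ¬ IsTwoShellGood (1 / 20) (47 / 50) 1 (Blocks.blockConfig P K) a ↔
      ¬ IsTwoShellGoodSet (1 / 20) (47 / 50) 1 P.points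
        (((Fintype.equivFin (Blocks.BIdx P K)).symm a).1 : EuclideanSpace ℝ (Fin 3)) := by
  rw [not_iff_not, block_good_iff P K hdeep]
  have hxa : Blocks.blockConfig P K a =
      (((Fintype.equivFin (Blocks.BIdx P K)).symm a).1 : EuclideanSpace ℝ (Fin 3)) +
        Blocks.latVec P (Blocks.coords K ((Fintype.equivFin (Blocks.BIdx P K)).symm a).2) := rfl
  rw [hxa]
  exact isTwoShellGoodSet_add_iff P (Blocks.latVec_mem P _) _

/-- **Counting.**  The block `x_K` has at least `#bad motif · (K³ − 6·depth·K²)` bad indices: every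
pair (bad motif point, deep coordinate triple) gives a distinct bad block index (`block_bad_iff`),
and at most `6·depth·K²` coordinate triples are not deep (`Blocks.card_not_deep_le`). [folklore] -/
theorem card_bad_block_ge :
    ((P.motif.filter fun y => ¬ IsTwoShellGoodSet (1 / 20) (47 / 50) 1 P.points y).card : ℝ) *
        ((K : ℝ) ^ 3 - 6 * (Blocks.depth P 2 : ℝ) * (K : ℝ) ^ 2) ≤
      (Nat.card {i : Fin (Fintype.card (Blocks.BIdx P K)) //
        ¬ IsTwoShellGood (1 / 20) (47 / 50) 1 (Blocks.blockConfig P K) i} : ℝ) := by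
  set e := Fintype.equivFin (Blocks.BIdx P K) with he
  set d : ℕ := Blocks.depth P 2 with hd
  set BadM : Finset (EuclideanSpace ℝ (Fin 3)) :=
    P.motif.filter fun y => ¬ IsTwoShellGoodSet (1 / 20) (47 / 50) 1 P.points y with hBadM
  set Df : Fin (Fintype.card (Blocks.BIdx P K)) → Prop := fun i =>
    ¬ IsTwoShellGood (1 / 20) (47 / 50) 1 (Blocks.blockConfig P K) i with hDf
  set S : Finset (Fin (Fintype.card (Blocks.BIdx P K))) := Finset.univ.filter fun i => Df i with hS
  have hcardS : Nat.card {i : Fin (Fintype.card (Blocks.BIdx P K)) // Df i} = S.card := by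
    rw [Nat.card_eq_fintype_card, Fintype.card_subtype]
  set Deep : Finset (Fin 3 → Fin K) := Finset.univ.filter fun k => Blocks.IsDeep K d k with hDeep
  -- (1) the injection (bad motif point, deep coordinates) ↦ block index
  have hinj : (BadM.attach ×ˢ Deep).card ≤ S.card := by
    refine Finset.card_le_card_of_injOn
      (fun p => e (⟨p.1.1, (Finset.mem_filter.1 p.1.2).1⟩, p.2)) (fun p hp => ?_) ?_
    · have hp' := Finset.mem_product.1 hp
      have hk : Blocks.IsDeep K d p.2 := (Finset.mem_filter.1 hp'.2).2
      have hbad : ¬ IsTwoShellGoodSet (1 / 20) (47 / 50) 1 P.points p.1.1 := (Finset.mem_filter.1 p.1.2).2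
      rw [Finset.mem_coe, hS, Finset.mem_filter]
      refine ⟨Finset.mem_univ _, ?_⟩
      have hsymm : e.symm (e (⟨p.1.1, (Finset.mem_filter.1 p.1.2).1⟩, p.2)) =
          (⟨p.1.1, (Finset.mem_filter.1 p.1.2).1⟩, p.2) := e.symm_apply_apply _
      have hdeep' : Blocks.IsDeep K (Blocks.depth P 2)
          (e.symm (e (⟨p.1.1, (Finset.mem_filter.1 p.1.2).1⟩, p.2))).2 := by
        rw [hsymm]; exact hk
      have key := block_bad_iff P K hdeep'
      rw [hsymm] at key
      exact key.2 hbad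
    · intro p _ q _ hpq
      obtain ⟨h1, h2⟩ := Prod.mk.inj (e.injective hpq)
      have h11 : p.1.1 = q.1.1 := by simpa using congrArg Subtype.val h1
      exact Prod.ext (Subtype.ext h11) h2
  -- (2) the number of deep coordinate triples
  have hDeepCard : (K : ℝ) ^ 3 - 6 * (d : ℝ) * (K : ℝ) ^ 2 ≤ (Deep.card : ℝ) := by
    have hsplit := Finset.card_filter_add_card_filter_not
      (s := (Finset.univ : Finset (Fin 3 → Fin K))) (fun k => Blocks.IsDeep K d k)
    have huniv : (Finset.univ : Finset (Fin 3 → Fin K)).card = K ^ 3 := by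
      rw [Finset.card_univ, Fintype.card_fun, Fintype.card_fin, Fintype.card_fin]
    have hnot : (Finset.univ.filter fun k : Fin 3 → Fin K => ¬ Blocks.IsDeep K d k).card ≤
        6 * d * K ^ 2 := by
      convert Blocks.card_not_deep_le K d
    rw [huniv] at hsplit
    have h1 : (Deep.card : ℝ) +
        ((Finset.univ.filter fun k : Fin 3 → Fin K => ¬ Blocks.IsDeep K d k).card : ℝ) =
          (K : ℝ) ^ 3 := by
      rw [hDeep]; exact_mod_cast hsplit
    have h2 : ((Finset.univ.filter fun k : Fin 3 → Fin K => ¬ Blocks.IsDeep K d k).card : ℝ) ≤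
        6 * (d : ℝ) * (K : ℝ) ^ 2 := by exact_mod_cast hnot
    linarith
  -- (3) assemble
  have hprod : ((BadM.attach ×ˢ Deep).card : ℝ) = (BadM.card : ℝ) * (Deep.card : ℝ) := by
    rw [Finset.card_product, Finset.card_attach, Nat.cast_mul]
  have hD0 : (0 : ℝ) ≤ (BadM.card : ℝ) := Nat.cast_nonneg _
  have hinj' : (BadM.card : ℝ) * (Deep.card : ℝ) ≤ (S.card : ℝ) := by
    rw [← hprod]; exact_mod_cast hinj
  have hN : (Nat.card {i : Fin (Fintype.card (Blocks.BIdx P K)) // Df i} : ℝ) = (S.card : ℝ) := by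
    exact_mod_cast hcardS
  rw [hN]
  exact (mul_le_mul_of_nonneg_left hDeepCard hD0).trans hinj'

/-- **Blocks of a separated periodic configuration are separated**: if `P.points` is
`1/3`-separated then so is every block `x_K` (its entries are distinct points of `P.points`).
[folklore] -/
theorem block_separated (hsep : ∀ u ∈ P.points, ∀ v ∈ P.points, u ≠ v → (1 / 3 : ℝ) ≤ dist u v) :
    ∀ i j : Fin (Fintype.card (Blocks.BIdx P K)), i ≠ j →
      (1 / 3 : ℝ) ≤ dist (Blocks.blockConfig P K i) (Blocks.blockConfig P K j) := fun _ _ hij =>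
  hsep _ (Blocks.bpt_mem P K _) _ (Blocks.bpt_mem P K _)
    ((Blocks.blockConfig_injective P K).ne hij)

/-- **One block.**  The `1/3`-separated finite two-shell gap with constant `g` applied to the block
`x_K` of a periodic `P` with `1/3`-separated point set gives
`#motif · K³ · e* + g · #bad motif · (K³ − 6 d K²) ≤ E_LJ(x_K)`. [folklore] -/
theorem sepGap_block {g : ℝ} (hg : 0 < g)
    (hG : ∀ (N : ℕ) (x : Fin N → EuclideanSpace ℝ (Fin 3)),
      (∀ i j : Fin N, i ≠ j → (1 / 3 : ℝ) ≤ dist (x i) (x j)) →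
      (N : ℝ) * (⨅ Q : PeriodicConfiguration 3, Q.energyPerParticle lennardJones)
        + g * (Nat.card {i : Fin N // ¬ IsTwoShellGood (1 / 20) (47 / 50) 1 x i} : ℝ)
        ≤ interactionEnergy lennardJones x)
    (hsep : ∀ u ∈ P.points, ∀ v ∈ P.points, u ≠ v → (1 / 3 : ℝ) ≤ dist u v) :
    (P.motif.card : ℝ) * (K : ℝ) ^ 3 * (⨅ Q : PeriodicConfiguration 3, Q.energyPerParticle lennardJones) +
        g * (((P.motif.filter fun y => ¬ IsTwoShellGoodSet (1 / 20) (47 / 50) 1 P.points y).card : ℝ) *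
          ((K : ℝ) ^ 3 - 6 * (Blocks.depth P 2 : ℝ) * (K : ℝ) ^ 2)) ≤
      interactionEnergy lennardJones (Blocks.blockConfig P K) := by
  have h1 := hG _ (Blocks.blockConfig P K) (block_separated P K hsep)
  have hN : ((Fintype.card (Blocks.BIdx P K) : ℕ) : ℝ) = (P.motif.card : ℝ) * (K : ℝ) ^ 3 := by
    rw [Blocks.card_BIdx]; push_cast; ring
  rw [hN] at h1
  have hcount := mul_le_mul_of_nonneg_left (card_bad_block_ge P K) hg.le
  linarith

/-- **Finite `1/3`-separated two-shell gap ⇒ torus two-shell gap** (same `g`): trial blocks of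
the periodic configuration carry its bad motif fraction and its energy per particle up to
`o(1)`; see the module docstring. [folklore] -/
theorem torusTwoShellGap_of_sepTwoShellGap
    (h : ∃ g : ℝ, 0 < g ∧ ∀ (N : ℕ) (x : Fin N → EuclideanSpace ℝ (Fin 3)),
      (∀ i j : Fin N, i ≠ j → (1 / 3 : ℝ) ≤ dist (x i) (x j)) →
      (N : ℝ) * (⨅ Q : PeriodicConfiguration 3, Q.energyPerParticle lennardJones)
        + g * (Nat.card {i : Fin N // ¬ IsTwoShellGood (1 / 20) (47 / 50) 1 x i} : ℝ)
        ≤ interactionEnergy lennardJones x) :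
    ∃ g : ℝ, 0 < g ∧ ∀ P : PeriodicConfiguration 3,
      (∀ u ∈ P.points, ∀ v ∈ P.points, u ≠ v → (1 / 3 : ℝ) ≤ dist u v) →
      (⨅ Q : PeriodicConfiguration 3, Q.energyPerParticle lennardJones)
        + g * ((P.motif.filter fun y => ¬ IsTwoShellGoodSet (1 / 20) (47 / 50) 1 P.points y).card : ℝ)
            / (P.motif.card : ℝ)
        ≤ P.energyPerParticle lennardJones := by
  obtain ⟨g, hg, hG⟩ := h
  refine ⟨g, hg, fun P hsep => ?_⟩
  rw [mul_div_assoc]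
  set eP : ℝ := (⨅ Q : PeriodicConfiguration 3, Q.energyPerParticle lennardJones) with heP
  set m : ℝ := (P.motif.card : ℝ) with hmdef
  have hm : 0 < m := by rw [hmdef]; exact_mod_cast P.motif_nonempty.card_pos
  set D : ℝ := ((P.motif.filter fun y => ¬ IsTwoShellGoodSet (1 / 20) (47 / 50) 1 P.points y).card : ℝ)
    with hDdef
  have hD0 : 0 ≤ D := Nat.cast_nonneg _
  have hDm : D ≤ m := by
    rw [hDdef, hmdef]
    exact_mod_cast Finset.card_le_card (Finset.filter_subset _ _)
  set d : ℝ := (Blocks.depth P 2 : ℝ) with hddef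
  have hd0 : 0 ≤ d := Nat.cast_nonneg _
  refine le_of_forall_pos_lt_add fun ε hε => ?_
  -- block energy for `K ≥ K₀`, and `K` large enough for the error term
  obtain ⟨K₀, hK₀, hK⟩ := Blocks.exists_block_energy_le P (show (0 : ℝ) < ε / 4 by positivity)
  obtain ⟨K₁, hK₁⟩ := exists_nat_gt (4 * (6 * d * g) / ε)
  obtain ⟨Kn, hKn0, hKn1⟩ : ∃ Kn : ℕ, K₀ ≤ Kn ∧ K₁ ≤ Kn := ⟨max K₀ K₁, le_max_left _ _, le_max_right _ _⟩
  have hKpos : 0 < Kn := lt_of_lt_of_le hK₀ hKn0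
  set k : ℝ := (Kn : ℝ) with hkdef
  have hk : 0 < k := by rw [hkdef]; exact_mod_cast hKpos
  have hk1 : 4 * (6 * d * g) / ε < k := hK₁.trans_le (by rw [hkdef]; exact_mod_cast hKn1)
  -- the two inequalities on the block `x_Kn`
  have hlow := sepGap_block P Kn hg hG hsep
  have hup := hK Kn hKn0
  have hN : ((Fintype.card (Blocks.BIdx P Kn) : ℕ) : ℝ) = m * k ^ 3 := by
    rw [Blocks.card_BIdx]; push_cast; rw [hmdef, hkdef]
  rw [hN] at hup
  -- combine: m k³ eP + g D (k³ − 6 d k²) ≤ m k³ (e P + ε/4)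
  have hcomb : m * k ^ 3 * eP + g * (D * (k ^ 3 - 6 * d * k ^ 2)) ≤
      m * k ^ 3 * (P.energyPerParticle lennardJones + ε / 4) := hlow.trans hup
  have herr2 : 6 * d * g < k * (ε / 4) := by
    have := (div_lt_iff₀ hε).1 hk1
    linarith
  have hk2 : 0 < k ^ 2 := by positivity
  have hmain : k * (m * eP + g * D) ≤ k * (m * P.energyPerParticle lennardJones + m * (ε / 4)) +
      6 * d * g * D := by
    have : k ^ 2 * (k * (m * eP + g * D)) ≤
        k ^ 2 * (k * (m * P.energyPerParticle lennardJones + m * (ε / 4)) + 6 * d * g * D) := by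
      nlinarith
    exact le_of_mul_le_mul_left this hk2
  have hmain2 : k * (m * eP + g * D) < k * (m * P.energyPerParticle lennardJones + m * (ε / 2)) := by
    have h3 : 6 * d * g * D ≤ m * (6 * d * g) := by
      have := mul_le_mul_of_nonneg_left hDm (by positivity : (0 : ℝ) ≤ 6 * d * g)
      linarith
    have h4 : m * (6 * d * g) < m * (k * (ε / 4)) := mul_lt_mul_of_pos_left herr2 hm
    nlinarith
  have hmain3 : m * eP + g * D < m * P.energyPerParticle lennardJones + m * (ε / 2) :=
    lt_of_mul_lt_mul_left hmain2 hk.le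
  have hfin : eP + g * (D / m) < P.energyPerParticle lennardJones + ε / 2 := by
    have h1 : eP + g * (D / m) = (m * eP + g * D) / m := by field_simp
    have h2 : (P.energyPerParticle lennardJones + ε / 2) * m =
        m * P.energyPerParticle lennardJones + m * (ε / 2) := by ring
    rw [h1, div_lt_iff₀ hm, h2]
    exact hmain3
  linarith

/-- **The crux implies its torus form** (`δ := 1/3`). [folklore] -/
theorem torusTwoShellGap_of_coerciveTwoShellGap
    (h : Summit.AtomisticToContinuum.Crystallization.Theses.PhononSlackCertificates.CoerciveTwoShellGap) :
    ∃ g : ℝ, 0 < g ∧ ∀ P : PeriodicConfiguration 3,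
      (∀ u ∈ P.points, ∀ v ∈ P.points, u ≠ v → (1 / 3 : ℝ) ≤ dist u v) →
      (⨅ Q : PeriodicConfiguration 3, Q.energyPerParticle lennardJones)
        + g * ((P.motif.filter fun y => ¬ IsTwoShellGoodSet (1 / 20) (47 / 50) 1 P.points y).card : ℝ)
            / (P.motif.card : ℝ)
        ≤ P.energyPerParticle lennardJones :=
  torusTwoShellGap_of_sepTwoShellGap (h (1 / 3) (by norm_num))

/-- **The crux IS its torus form**: `CoerciveTwoShellGap ↔` the two-shell gap on the torus
(⇒ trial blocks, this file; ⇐ the landed line stubs `stub_periodisation` (periodisation) and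
`stub_sepReduction` (closest-pair deletion)). [folklore] -/
theorem coerciveTwoShellGap_iff_torusTwoShellGap :
    Summit.AtomisticToContinuum.Crystallization.Theses.PhononSlackCertificates.CoerciveTwoShellGap ↔
    ∃ g : ℝ, 0 < g ∧ ∀ P : PeriodicConfiguration 3,
      (∀ u ∈ P.points, ∀ v ∈ P.points, u ≠ v → (1 / 3 : ℝ) ≤ dist u v) →
      (⨅ Q : PeriodicConfiguration 3, Q.energyPerParticle lennardJones)
        + g * ((P.motif.filter fun y => ¬ IsTwoShellGoodSet (1 / 20) (47 / 50) 1 P.points y).card : ℝ)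
            / (P.motif.card : ℝ)
        ≤ P.energyPerParticle lennardJones :=
  ⟨torusTwoShellGap_of_coerciveTwoShellGap, fun h =>
    CoerciveTwoShellGapSepReduction.stub_sepReduction
      (CoerciveTwoShellGapPeriodisation.stub_periodisation h)⟩

/-- **The crux IS its `1/3`-separated instance** (one `g`, no `δ`): ⇒ instantiate `δ := 1/3`;
⇐ `stub_sepReduction`. [folklore] -/
theorem coerciveTwoShellGap_iff_sepTwoShellGap :
    Summit.AtomisticToContinuum.Crystallization.Theses.PhononSlackCertificates.CoerciveTwoShellGap ↔
    ∃ g : ℝ, 0 < g ∧ ∀ (N : ℕ) (x : Fin N → EuclideanSpace ℝ (Fin 3)),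
      (∀ i j : Fin N, i ≠ j → (1 / 3 : ℝ) ≤ dist (x i) (x j)) →
      (N : ℝ) * (⨅ Q : PeriodicConfiguration 3, Q.energyPerParticle lennardJones)
        + g * (Nat.card {i : Fin N // ¬ IsTwoShellGood (1 / 20) (47 / 50) 1 x i} : ℝ)
        ≤ interactionEnergy lennardJones x :=
  ⟨fun h => h (1 / 3) (by norm_num), CoerciveTwoShellGapSepReduction.stub_sepReduction⟩

/-- **Registered sub-goal `stub_blocksConverse`** (lead, line `Sketch`; not part of the
composition `CoerciveTwoShellGap_of`): the finite `1/3`-separated two-shell gap implies the torus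
two-shell gap — `torusTwoShellGap_of_sepTwoShellGap`.  Together with the composition stubs it
records that the line's torus core is EQUIVALENT to the crux. [folklore] -/
theorem stub_blocksConverse :
    (∃ g : ℝ, 0 < g ∧ ∀ (N : ℕ) (x : Fin N → EuclideanSpace ℝ (Fin 3)),
      (∀ i j : Fin N, i ≠ j → (1 / 3 : ℝ) ≤ dist (x i) (x j)) →
      (N : ℝ) * (⨅ Q : PeriodicConfiguration 3, Q.energyPerParticle lennardJones)
        + g * (Nat.card {i : Fin N // ¬ IsTwoShellGood (1 / 20) (47 / 50) 1 x i} : ℝ)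
        ≤ interactionEnergy lennardJones x) →
    ∃ g : ℝ, 0 < g ∧ ∀ P : PeriodicConfiguration 3,
      (∀ u ∈ P.points, ∀ v ∈ P.points, u ≠ v → (1 / 3 : ℝ) ≤ dist u v) →
      (⨅ Q : PeriodicConfiguration 3, Q.energyPerParticle lennardJones)
        + g * ((P.motif.filter fun y => ¬ IsTwoShellGoodSet (1 / 20) (47 / 50) 1 P.points y).card : ℝ)
            / (P.motif.card : ℝ)
        ≤ P.energyPerParticle lennardJones :=
  torusTwoShellGap_of_sepTwoShellGap

end Summit.AtomisticToContinuum.Crystallization.Theorems.CoerciveTwoShellGapBlocks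

end
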